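import Summits.ValiantsHypothesis.ValiantsHypothesis.Theorems.LacunarySymmetroidMatrixDescartesCensusChamberPi920

/-!
# `MatrixDescartes` census — the Π-kill CHAMBER-UNIFORMLY: schema for the pattern of cell 920−, and the complete door-A
rows on chambers 920 and 1844 (the sign-level atlas of door A has no open cell left)

HONEST FRAMING.  Object-search cell `pub-symmetroid`, door-A target `DoorA26 := PosRootLawAt 2 6 19`
(stmt-ValiantsHypothesis-19979; OPEN, typed, never asserted).  `no_twenty_on_chamber_cell_pi920` reads the sign
    pattern of
cell 920− (six indefinite letters, fifteen pairing signs) off a chamber order for SYMBOLIC exponents and applies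
`Census.pi920_false`; `posRootLawOn_of_chamber_parity_pi920` combines it with a parity cell; the instances are chamber 920
(letters in order) and its mirror 1844 (letters relabelled `0 1 3 2 4 5`), both with the other cell
    parity-dead.  With these
two rows 246 of the 2 608 chambers are dead at sign level in both orientations, all in the kernel, and EVERY `V
    = 20` cell of
the atlas is either rule-dead (parity 2 278, L-tri 100, Λ 18, Π 2) or carries an exact Lorentz–Gram witness (2
    818; tables in
HOME/val-sym-door-p2/g2/).  SIGN layer only: a realised cell says nothing about root counts; nothing here
    bounds ζ_sym(2,6),
nothing on `DoorA26` as a whole (OPEN), the crux `MatrixDescartes` (stmt-ValiantsHypothesis-18050), or `VP ≠ VNP`.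

[folklore] Bookkeeping; no citation exists or is needed.
-/

-- `Summit.ValiantsHypothesis.ValiantsHypothesis.…` repeats a component by the D-0017 layout
-- (single-conjunct summit), which the `dupNamespace` linter flags; the name is mandated.
set_option linter.dupNamespace false

namespace Summit.ValiantsHypothesis.ValiantsHypothesis.Theorems.LacunarySymmetroidMatrixDescartes.Census

open Polynomial Finset
open scoped BigOperators Polynomial Matrix

/-! ## The chamber-uniform schema for the Π-pattern of cell 920− (and, by relabelling, 1844−) -/

/-- **ONE-ORIENTATION CHAMBER-UNIFORM Π-KILL (pattern of cell 920−).**  `σ` lists the 21 pairs in the order of their sums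
(`σ 0 = (i₀,i₀)` lowest); `η` encodes the orientation «`(−1)^η det S_{i₀} > 0`».  Data: six distinct letters
    `l₀ … l₅`, the
positions of their diagonal pairs (parity `η + 1`: all six INDEFINITE) and of the fifteen mixed pairs with the
    parities of
the sign pattern of cell 920− of theory g6's table (`+` at `01 03 05 12 13 23 24 34 35 45`, `−` at `02 04 14 15 25`) —
all decidable.  Then on EVERY exponent vector `d` of the chamber no real symmetric `2 × 2` pencil of that
    orientation has
`20 = D(2,6)` distinct positive det-roots (`Census.pi920_false`). [folklore] -/
theorem no_twenty_on_chamber_cell_pi920 (σ : Fin 21 → Fin 6 × Fin 6) (η : ℕ) (i₀ l₀ l₁ l₂ l₃ l₄ l₅ : Fin 6)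
    (t₀ t₁ t₂ t₃ t₄ t₅ e01 e02 e03 e04 e05 e12 e13 e14 e15 e23 e24 e25 e34 e35 e45 : Fin 21)
    (hcert : (∀ p : Fin 6 × Fin 6, ∃ t : Fin 21, σ t = p ∨ σ t = p.swap) ∧ σ 0 = (i₀, i₀) ∧
      (l₀ ≠ l₁ ∧ l₀ ≠ l₂ ∧ l₀ ≠ l₃ ∧ l₀ ≠ l₄ ∧ l₀ ≠ l₅ ∧ l₁ ≠ l₂ ∧ l₁ ≠ l₃ ∧ l₁ ≠ l₄ ∧ l₁ ≠ l₅ ∧ l₂ ≠ l₃ ∧ l₂ ≠ l₄ ∧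
        l₂ ≠ l₅ ∧ l₃ ≠ l₄ ∧ l₃ ≠ l₅ ∧ l₄ ≠ l₅) ∧
      (σ t₀ = (l₀, l₀) ∧ σ t₁ = (l₁, l₁) ∧ σ t₂ = (l₂, l₂) ∧ σ t₃ = (l₃, l₃) ∧ σ t₄ = (l₄, l₄) ∧ σ t₅ = (l₅, l₅)) ∧
      ((σ e01 = (l₀, l₁) ∨ σ e01 = (l₁, l₀)) ∧ (σ e02 = (l₀, l₂) ∨ σ e02 = (l₂, l₀)) ∧
        (σ e03 = (l₀, l₃) ∨ σ e03 = (l₃, l₀)) ∧ (σ e04 = (l₀, l₄) ∨ σ e04 = (l₄, l₀)) ∧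
        (σ e05 = (l₀, l₅) ∨ σ e05 = (l₅, l₀)) ∧ (σ e12 = (l₁, l₂) ∨ σ e12 = (l₂, l₁)) ∧
        (σ e13 = (l₁, l₃) ∨ σ e13 = (l₃, l₁)) ∧ (σ e14 = (l₁, l₄) ∨ σ e14 = (l₄, l₁)) ∧
        (σ e15 = (l₁, l₅) ∨ σ e15 = (l₅, l₁)) ∧ (σ e23 = (l₂, l₃) ∨ σ e23 = (l₃, l₂)) ∧
        (σ e24 = (l₂, l₄) ∨ σ e24 = (l₄, l₂)) ∧ (σ e25 = (l₂, l₅) ∨ σ e25 = (l₅, l₂)) ∧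
        (σ e34 = (l₃, l₄) ∨ σ e34 = (l₄, l₃)) ∧ (σ e35 = (l₃, l₅) ∨ σ e35 = (l₅, l₃)) ∧
        (σ e45 = (l₄, l₅) ∨ σ e45 = (l₅, l₄))) ∧
      (Odd ((t₀ : ℕ) + η) ∧ Odd ((t₁ : ℕ) + η) ∧ Odd ((t₂ : ℕ) + η) ∧ Odd ((t₃ : ℕ) + η) ∧ Odd ((t₄ : ℕ) + η) ∧
        Odd ((t₅ : ℕ) + η)) ∧
      (Even ((e01 : ℕ) + η) ∧ Odd ((e02 : ℕ) + η) ∧ Even ((e03 : ℕ) + η) ∧ Odd ((e04 : ℕ) + η) ∧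
        Even ((e05 : ℕ) + η) ∧ Even ((e12 : ℕ) + η) ∧ Even ((e13 : ℕ) + η) ∧ Odd ((e14 : ℕ) + η) ∧
        Odd ((e15 : ℕ) + η) ∧ Even ((e23 : ℕ) + η) ∧ Even ((e24 : ℕ) + η) ∧ Odd ((e25 : ℕ) + η) ∧
        Even ((e34 : ℕ) + η) ∧ Even ((e35 : ℕ) + η) ∧ Even ((e45 : ℕ) + η)))
    (d : Fin 6 → ℕ) (hd : StrictMono ((fun p : Fin 6 × Fin 6 => d p.1 + d p.2) ∘ σ))
    (S : Fin 6 → Matrix (Fin 2) (Fin 2) ℝ) (hS : ∀ l, (S l).IsSymm)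
    (hZ : 20 ≤ ((∑ l, ((X : ℝ[X]) ^ d l) • (S l).map C).det.roots.toFinset.filter (fun t => 0 < t)).card)
    (hs : 0 < (-1 : ℝ) ^ η * (S i₀ 0 0 * S i₀ 1 1 - S i₀ 0 1 ^ 2)) : False := by
  obtain ⟨hcov, h0, ⟨n01, n02, n03, n04, n05, n12, n13, n14, n15, n23, n24, n25, n34, n35, n45⟩,
    ⟨ht₀, ht₁, ht₂, ht₃, ht₄, ht₅⟩, ⟨g01, g02, g03, g04, g05, g12, g13, g14, g15, g23, g24, g25, g34, g35, g45⟩,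
    ⟨pt₀, pt₁, pt₂, pt₃, pt₄, pt₅⟩, ⟨q01, q02, q03, q04, q05, q12, q13, q14, q15, q23, q24, q25, q34, q35,
        q45⟩⟩ := hcert
  set Pd := (∑ l, ((X : ℝ[X]) ^ d l) • (S l).map Polynomial.C).det with hP_def
  set W := (Finset.univ : Finset (Fin 6 × Fin 6)).image (fun p => d p.1 + d p.2) with hW_def
  have hN : W.card = 21 := card_pairSums_of_chamber σ hcov d hd
  have memW : ∀ u v : Fin 6, d u + d v ∈ W := fun u v =>
    Finset.mem_image.mpr ⟨(u, v), Finset.mem_univ _, rfl⟩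
  have hP : Pd ≠ 0 := by
    intro hP0
    have : (Pd.roots.toFinset.filter (fun t => 0 < t)).card = 0 := by rw [hP0]; simp
    omega
  have hsupp : Pd.support = W := by
    have hsub : Pd.support ⊆ W := by
      rw [hP_def, hW_def, ← sumset_two_eq_pairSums d]; exact support_det_pencil_subset_sumset d S
    refine Finset.eq_of_subset_of_card_le hsub ?_
    have h := Literature.Computability.AlgebraicComplexity.card_roots_toFinset_filter_pos_lt_card_support hP
    omega
  have hZ' : Pd.support.card ≤ (Pd.roots.toFinset.filter (fun t => 0 < t)).card + 1 := by
    rw [hsupp]; omega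
  have F1 : ∀ x y : ℕ, x ∈ W → y ∈ W →
      0 < (-1 : ℝ) ^ ((W.filter (· < x)).card + (W.filter (· < y)).card) * (Pd.coeff x * Pd.coeff y) := by
    intro x y hx hy
    have := pow_rank_mul_coeff_mul_coeff_pos_of_sharp Pd hZ' (by rw [hsupp]; exact hx) (by rw [hsupp]; exact hy)
    rwa [hsupp] at this
  have hsum : ∀ {t : Fin 21} {u v : Fin 6}, σ t = (u, v) → d u + d v = d (σ t).1 + d (σ t).2 := by
    intro t u v ht; rw [ht]
  have udiag : ∀ {t : Fin 21} {u : Fin 6}, σ t = (u, u) →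
      ∀ p : Fin 6 × Fin 6, d p.1 + d p.2 = d u + d u → p = (u, u) := by
    intro t u ht p hp
    rw [hsum ht] at hp
    rcases pair_eq_of_chamber σ hcov d hd t p hp with h | h
    · rw [h, ht]
    · rw [h, ht]; rfl
  have upair : ∀ {t : Fin 21} {u v : Fin 6}, σ t = (u, v) →
      ∀ p : Fin 6 × Fin 6, d p.1 + d p.2 = d u + d v → p = (u, v) ∨ p = (v, u) := by
    intro t u v ht p hp
    rw [hsum ht] at hp
    rcases pair_eq_of_chamber σ hcov d hd t p hp with h | h
    · left; rw [h, ht]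
    · right; rw [h, ht]; rfl
  have rk : ∀ {t : Fin 21} {u v : Fin 6}, σ t = (u, v) → (W.filter (· < d u + d v)).card = t := by
    intro t u v ht
    rw [hsum ht]
    exact card_filter_lt_of_chamber σ hcov d hd t
  have hsym : ∀ l, S l 1 0 = S l 0 1 := fun l => by
    have h := congrFun (congrFun (hS l) 1) 0
    simp only [Matrix.transpose_apply] at h
    exact h.symm
  have hdiag : ∀ {t : Fin 21} {u : Fin 6}, σ t = (u, u) → Pd.coeff (d u + d u) = S u 0 0 * S u 1 1 - S u 0 1 ^ 2 := by
    intro t u ht; rw [hP_def, coeff_det_pencil_two_diag d S u (udiag ht), hsym, sq]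
  have hpair : ∀ {t : Fin 21} {u v : Fin 6}, σ t = (u, v) → u ≠ v →
      Pd.coeff (d u + d v) = S u 0 0 * S v 1 1 + S u 1 1 * S v 0 0 - 2 * (S u 0 1 * S v 0 1) := by
    intro t u v ht huv; rw [hP_def, coeff_det_pencil_two_pair d S huv (upair ht), hsym, hsym]; ring
  have tw : ∀ x : ℕ, x ∈ W → 0 < (-1 : ℝ) ^ ((W.filter (· < x)).card + η) * Pd.coeff x := by
    intro x hx
    have h1 := F1 (d i₀ + d i₀) x (memW i₀ i₀) hx
    rw [rk h0, hdiag h0] at h1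
    simp only [Fin.val_zero, zero_add] at h1
    have h2 : 0 < ((-1 : ℝ) ^ (W.filter (· < x)).card * ((S i₀ 0 0 * S i₀ 1 1 - S i₀ 0 1 ^ 2) * Pd.coeff x)) *
        ((-1 : ℝ) ^ η * (S i₀ 0 0 * S i₀ 1 1 - S i₀ 0 1 ^ 2)) := mul_pos h1 hs
    have h3 : ((-1 : ℝ) ^ (W.filter (· < x)).card * ((S i₀ 0 0 * S i₀ 1 1 - S i₀ 0 1 ^ 2) * Pd.coeff x)) *
        ((-1 : ℝ) ^ η * (S i₀ 0 0 * S i₀ 1 1 - S i₀ 0 1 ^ 2))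
        = ((-1 : ℝ) ^ ((W.filter (· < x)).card + η) * Pd.coeff x) * (S i₀ 0 0 * S i₀ 1 1 - S i₀ 0 1 ^ 2) ^ 2 := by
      rw [pow_add]; ring
    rw [h3] at h2
    exact pos_of_mul_pos_left h2 (sq_nonneg _)
  -- indefinite letters: D = b² − ac > 0
  have hind : ∀ {t : Fin 21} {u : Fin 6}, σ t = (u, u) → Odd ((t : ℕ) + η) → 0 < S u 0 1 ^ 2 - S u 0 0 * S u 1 1 := by
    intro t u ht hod
    have := tw _ (memW u u)
    rw [rk ht, hod.neg_one_pow, hdiag ht] at this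
    linarith
  have hmix : ∀ {t : Fin 21} {u v : Fin 6}, σ t = (u, v) → u ≠ v →
      0 < (-1 : ℝ) ^ ((t : ℕ) + η) * (S u 0 0 * S v 1 1 + S u 1 1 * S v 0 0 - 2 * (S u 0 1 * S v 0 1)) := by
    intro t u v ht huv
    have := tw _ (memW u v)
    rwa [rk ht, hpair ht huv] at this
  have hmix' : ∀ {t : Fin 21} {u v : Fin 6}, (σ t = (u, v) ∨ σ t = (v, u)) → u ≠ v →
      0 < (-1 : ℝ) ^ ((t : ℕ) + η) * (S u 0 0 * S v 1 1 + S u 1 1 * S v 0 0 - 2 * (S u 0 1 * S v 0 1)) := by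
    intro t u v ht huv
    rcases ht with ht | ht
    · exact hmix ht huv
    · have h := hmix ht huv.symm
      have e : S v 0 0 * S u 1 1 + S v 1 1 * S u 0 0 - 2 * (S v 0 1 * S u 0 1)
          = S u 0 0 * S v 1 1 + S u 1 1 * S v 0 0 - 2 * (S u 0 1 * S v 0 1) := by ring
      rwa [e] at h
  have hpos : ∀ {t : Fin 21} {u v : Fin 6}, (σ t = (u, v) ∨ σ t = (v, u)) → u ≠ v → Even ((t : ℕ) + η) →
      0 < S u 0 0 * S v 1 1 + S u 1 1 * S v 0 0 - 2 * (S u 0 1 * S v 0 1) := by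
    intro t u v ht huv hev
    have := hmix' ht huv
    rwa [hev.neg_one_pow, one_mul] at this
  have hneg : ∀ {t : Fin 21} {u v : Fin 6}, (σ t = (u, v) ∨ σ t = (v, u)) → u ≠ v → Odd ((t : ℕ) + η) →
      S u 0 0 * S v 1 1 + S u 1 1 * S v 0 0 - 2 * (S u 0 1 * S v 0 1) < 0 := by
    intro t u v ht huv hod
    have := hmix' ht huv
    rw [hod.neg_one_pow] at this
    linarith
  exact pi920_false (S l₀ 0 0) (S l₀ 0 1) (S l₀ 1 1) (S l₁ 0 0) (S l₁ 0 1) (S l₁ 1 1) (S l₂ 0 0) (S l₂ 0 1) (S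
      l₂ 1 1) (S l₃ 0 0) (S l₃ 0 1) (S l₃ 1 1) (S l₄ 0 0) (S l₄ 0 1) (S l₄ 1 1) (S l₅ 0 0) (S l₅ 0 1) (S l₅ 1 1)
    (hind ht₀ pt₀) (hind ht₁ pt₁) (hind ht₂ pt₂) (hind ht₃ pt₃) (hind ht₄ pt₄) (hind ht₅ pt₅)
    (hpos g01 n01 q01) (hneg g02 n02 q02) (hpos g03 n03 q03) (hneg g04 n04 q04) (hpos g05 n05 q05)
    (hpos g12 n12 q12) (hpos g13 n13 q13) (hneg g14 n14 q14) (hneg g15 n15 q15) (hpos g23 n23 q23)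
    (hpos g24 n24 q24) (hneg g25 n25 q25) (hpos g34 n34 q34) (hpos g35 n35 q35) (hpos g45 n45 q45)

/-- **COMPLETE CHAMBER ROW from one parity cell and one Π-cell (pattern 920−).** [folklore] -/
theorem posRootLawOn_of_chamber_parity_pi920 (σ : Fin 21 → Fin 6 × Fin 6) (η : ℕ) (i₀ i j k : Fin 6)
    (a b c e f g : Fin 21) (l₀ l₁ l₂ l₃ l₄ l₅ : Fin 6)
    (t₀ t₁ t₂ t₃ t₄ t₅ e01 e02 e03 e04 e05 e12 e13 e14 e15 e23 e24 e25 e34 e35 e45 : Fin 21)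
    (hcert : (∀ p : Fin 6 × Fin 6, ∃ t : Fin 21, σ t = p ∨ σ t = p.swap) ∧ σ 0 = (i₀, i₀) ∧
      (i ≠ j ∧ j ≠ k ∧ i ≠ k) ∧
      (σ a = (i, i) ∧ σ b = (j, j) ∧ σ c = (k, k) ∧ σ e = (i, j) ∧ σ f = (j, k) ∧ σ g = (i, k)) ∧
      (Even ((a : ℕ) + η) ∧ Even ((b : ℕ) + η) ∧ Even ((c : ℕ) + η) ∧ Odd ((e : ℕ) + f + g + η)))
(hcert' : (∀ p : Fin 6 × Fin 6, ∃ t : Fin 21, σ t = p ∨ σ t = p.swap) ∧ σ 0 = (i₀, i₀) ∧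
      (l₀ ≠ l₁ ∧ l₀ ≠ l₂ ∧ l₀ ≠ l₃ ∧ l₀ ≠ l₄ ∧ l₀ ≠ l₅ ∧ l₁ ≠ l₂ ∧ l₁ ≠ l₃ ∧ l₁ ≠ l₄ ∧ l₁ ≠ l₅ ∧ l₂ ≠ l₃ ∧ l₂ ≠ l₄ ∧
        l₂ ≠ l₅ ∧ l₃ ≠ l₄ ∧ l₃ ≠ l₅ ∧ l₄ ≠ l₅) ∧
      (σ t₀ = (l₀, l₀) ∧ σ t₁ = (l₁, l₁) ∧ σ t₂ = (l₂, l₂) ∧ σ t₃ = (l₃, l₃) ∧ σ t₄ = (l₄, l₄) ∧ σ t₅ = (l₅, l₅)) ∧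
      ((σ e01 = (l₀, l₁) ∨ σ e01 = (l₁, l₀)) ∧ (σ e02 = (l₀, l₂) ∨ σ e02 = (l₂, l₀)) ∧
        (σ e03 = (l₀, l₃) ∨ σ e03 = (l₃, l₀)) ∧ (σ e04 = (l₀, l₄) ∨ σ e04 = (l₄, l₀)) ∧
        (σ e05 = (l₀, l₅) ∨ σ e05 = (l₅, l₀)) ∧ (σ e12 = (l₁, l₂) ∨ σ e12 = (l₂, l₁)) ∧
        (σ e13 = (l₁, l₃) ∨ σ e13 = (l₃, l₁)) ∧ (σ e14 = (l₁, l₄) ∨ σ e14 = (l₄, l₁)) ∧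
        (σ e15 = (l₁, l₅) ∨ σ e15 = (l₅, l₁)) ∧ (σ e23 = (l₂, l₃) ∨ σ e23 = (l₃, l₂)) ∧
        (σ e24 = (l₂, l₄) ∨ σ e24 = (l₄, l₂)) ∧ (σ e25 = (l₂, l₅) ∨ σ e25 = (l₅, l₂)) ∧
        (σ e34 = (l₃, l₄) ∨ σ e34 = (l₄, l₃)) ∧ (σ e35 = (l₃, l₅) ∨ σ e35 = (l₅, l₃)) ∧
        (σ e45 = (l₄, l₅) ∨ σ e45 = (l₅, l₄))) ∧
      (Odd ((t₀ : ℕ) + (η + 1)) ∧ Odd ((t₁ : ℕ) + (η + 1)) ∧ Odd ((t₂ : ℕ) + (η + 1)) ∧ Odd ((t₃ : ℕ) + (η +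
          1)) ∧ Odd ((t₄ : ℕ) + (η + 1)) ∧
        Odd ((t₅ : ℕ) + (η + 1))) ∧
      (Even ((e01 : ℕ) + (η + 1)) ∧ Odd ((e02 : ℕ) + (η + 1)) ∧ Even ((e03 : ℕ) + (η + 1)) ∧ Odd ((e04 : ℕ) + (η + 1)) ∧
        Even ((e05 : ℕ) + (η + 1)) ∧ Even ((e12 : ℕ) + (η + 1)) ∧ Even ((e13 : ℕ) + (η + 1)) ∧ Odd ((e14 : ℕ) +
            (η + 1)) ∧
        Odd ((e15 : ℕ) + (η + 1)) ∧ Even ((e23 : ℕ) + (η + 1)) ∧ Even ((e24 : ℕ) + (η + 1)) ∧ Odd ((e25 : ℕ) +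
            (η + 1)) ∧
        Even ((e34 : ℕ) + (η + 1)) ∧ Even ((e35 : ℕ) + (η + 1)) ∧ Even ((e45 : ℕ) + (η + 1))))
    (d : Fin 6 → ℕ) (hd : StrictMono ((fun p : Fin 6 × Fin 6 => d p.1 + d p.2) ∘ σ)) : PosRootLawOn 2 6 19 d :=
  posRootLawOn_of_chamber_cell σ η i₀ i j k a b c e f g hcert d hd
    (fun S hS hZ hs => no_twenty_on_chamber_cell_pi920 σ (η + 1) i₀ l₀ l₁ l₂ l₃ l₄ l₅ t₀ t₁ t₂ t₃ t₄ t₅ e01 e02 e03 e04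
      e05 e12 e13 e14 e15 e23 e24 e25 e34 e35 e45 hcert' d hd S hS hZ hs)

/-! ## The two complete rows -/

/-- **Door-A row on the whole chamber 920** of theory g6's table (mirror 1844; smallest member
`(0,8,11,15,25,31)`, words `DDDDDD` / `IIIIII`): the `s = +` cell dies by the odd definite triangle `{0,1,3}`,
the `s = −` cell — the last sign-open pair of the atlas — by the Π-rule (interval model: the near-graph of six
indefinite letters must be a co-comparability graph in every chart); hence `ζ(2,6; d) ≤ 19` for EVERY exponent vector
of the chamber. [folklore] -/
theorem doorA26_on_chamber920 (d : Fin 6 → ℕ)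
    (hd : StrictMono ((fun p : Fin 6 × Fin 6 => d p.1 + d p.2) ∘
      ![(0, 0), (0, 1), (0, 2), (0, 3), (1, 1), (1, 2), (2, 2), (1, 3), (0, 4), (2, 3), (3, 3),
        (0, 5), (1, 4), (2, 4), (1, 5), (3, 4), (2, 5), (3, 5), (4, 4), (4, 5), (5, 5)])) :
    PosRootLawOn 2 6 19 d :=
  posRootLawOn_of_chamber_parity_pi920 _ 0 0 0 1 3 0 4 10 1 7 3
    0 1 2 3 4 5 0 4 6 10 18 20
    1 2 3 8 11 5 7 12 14 9 13 16 15 17 19 (by decide)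
    (by refine ⟨?_, ?_, ?_, ?_, ?_, ?_, ?_⟩ <;> decide) d hd

/-- **Door-A row on the whole chamber 1844** of theory g6's table (mirror 920; smallest member
`(0,6,16,20,23,31)`, words `DDDDDD` / `IIIIII`): the `s = +` cell dies by the odd definite triangle `{0,1,2}`,
the `s = −` cell — the last sign-open pair of the atlas — by the Π-rule (interval model: the near-graph of six
indefinite letters must be a co-comparability graph in every chart); hence `ζ(2,6; d) ≤ 19` for EVERY exponent vector
of the chamber. [folklore] -/
theorem doorA26_on_chamber1844 (d : Fin 6 → ℕ)
    (hd : StrictMono ((fun p : Fin 6 × Fin 6 => d p.1 + d p.2) ∘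
      ![(0, 0), (0, 1), (1, 1), (0, 2), (0, 3), (1, 2), (0, 4), (1, 3), (1, 4), (0, 5), (2, 2),
        (2, 3), (1, 5), (2, 4), (3, 3), (3, 4), (4, 4), (2, 5), (3, 5), (4, 5), (5, 5)])) :
    PosRootLawOn 2 6 19 d :=
  posRootLawOn_of_chamber_parity_pi920 _ 0 0 0 1 2 0 2 10 1 5 3
    0 1 3 2 4 5 0 2 14 10 16 20
    1 4 3 6 9 7 5 8 12 11 15 18 13 17 19 (by decide)
    (by refine ⟨?_, ?_, ?_, ?_, ?_, ?_, ?_⟩ <;> decide) d hd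

/-- The smallest support of chamber 920, `(0,8,11,15,25,31)`, by the decidable membership test. [folklore] -/
example : PosRootLawOn 2 6 19 (![0, 8, 11, 15, 25, 31] : Fin 6 → ℕ) :=
  doorA26_on_chamber920 _ (Fin.strictMono_iff_lt_succ.2 (by decide))

end Summit.ValiantsHypothesis.ValiantsHypothesis.Theorems.LacunarySymmetroidMatrixDescartes.Census
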